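import Summits.QuantumFields.Balaban3D.Proofs.UVStability3DInputs

/-!
# Bałaban CMP 102 (1985), d = 3 lane — `Proofs.FamilyLE`: **THE END THEOREM ON THE `≤`-FAMILY** `g²ε₀ ≤ (min γ₀ 1)²` (terminal
# coupling AT MOST the leaf threshold, instead of EQUAL to it) — the cell `ym3-torus` interface I-3 («terminal-coupling quantisation»)
# closed by the mechanical port its census predicted

Source: T. Bałaban, *Ultraviolet stability of three-dimensional lattice pure gauge field theories*, Commun. Math. Phys. **102** (1985)
255–275 [Balaban1985UV3] ([B10]; PDF page = journal page − 254): p. 256 L15–18 «when L^kε = ε₀, where ε₀ is a positive constant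
depending on the coupling constant g only», p. 257 L1–2 «the constant O(1) is independent of ε, k, g_k in a bounded set», p. 259 L1
«For g₀ sufficiently small», p. 267 L7–8 / p. 268 «for g_k sufficiently small».  Cell `ym3-torus` (HUMAN RULING D-0037, YM ladder rung
R3), seat p1 gen 3; TARGET.md v3 §2 N4 INTERFACE I-3 and §6 Q6.

WHY.  The lane's END theorem `UVStability3DInputs.uvStability3D_of_inputs` (and the cell's P1-7 files `RestrictedResiduals*`) quantify over
the EXHIBITED family `S.ε₀ = ε₀(S.g) = (min γ₀ 1)²/S.g²` (ruling R-EPS0′: print's «ε₀ depending on g only» with ONE ε₀ per g), which PINS the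
terminal coupling `g_K² = g²ε₀ = (min γ₀ 1)² =: γ⋆` (`Constants.gsq_mul_eps0Of`).  The cell's R3 assembly refines unit-lattice schemes
(`T3LevelShift`, TARGET v3 §2 N9 / I-3): a scheme tower at coupling γ is a family member only for `γ ∈ γ⋆·L^ℤ`, so AS TYPED the (α)/UV3
rows feed the R3 nodes N5a/N6a on a lattice of couplings, not on the interval `(0, γ₁]` the headline `Y1_SU2` asks for.  Print's wording is
the interval one («g_k in a bounded set», «g_k sufficiently small»), and the lane consumes the family equation ONLY through
`ScalesArithmetic.gk_le_gamma0_of_eps0Of : g_k ≤ γ₀ (k ≤ K)` (census, TARGET v3 §2 N4 I-3: `Family.lean` :39–63, `UVStability3DInputs.lean`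
:250–311; `gK_eq_of_eps0Of` as an EQUALITY is used by the negative edge `NegativeEdge`/`not_literal_*` only, which is about the literal
reading and irrelevant here).  This file IS that census, kernel-checked: the same proofs with the hypothesis weakened to
`S.g²·S.ε₀ ≤ (min γ₀ 1)²`.

WHAT THIS FILE PROVES.
* §1 `ScalesLE L γ := {S : Scales L // S.g²·S.ε₀ ≤ γ}`, `runsLE`; `le_of_eps0Of` (the exhibited family lies in the `≤`-family at
  `γ⋆ = (min γ₀ 1)²`); `gk_le_gamma0_of_le : g_k ≤ γ₀ (k ≤ K)` on the `≤`-family; the four leaf thresholds and (28)-smallness there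
  (`thresholds_of_le`).
* §2 `bound25_act_of_le`, `stepResiduals_of_alpha_le`, `runResiduals_of_alpha_le` — `UVStability3DInputs.bound25_act` /
  `stepResiduals_of_alpha` / `runResiduals_of_alpha` VERBATIM with `hS` replaced by the `≤`-hypothesis.
* §3 **`uvStability3D_of_inputs_le`**: for every group as printed `(G, 𝔊)`, IF the (α) inputs `RunAlpha` hold for every `S` of the
  `≤`-family `S.g²·S.ε₀ ≤ (min γ₀ 1)²`, THEN `B10.Thm1PrintedCompact (runsLE …) ∧ B10.Thm2Printed (runsLE …)` — Theorem 1 (compact-coupling-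
  window reading: one O(1) per window `[gmin, gmax]`, uniform over the whole `≤`-family) and Theorem 2 ((41) ∧ (47), `k ≤ K`) for the
  densities of the CONSTRUCTED runs `(laneT 𝔠 X 𝔖).toConstruction`, over ALL lattice approximations with terminal coupling at most
  `min γ₀ 1`; `thm2_eps0Of_of_le` recovers the exhibited-family reading of Theorem 2 from it.
HONEST FRAMING (lane PLAN.md §0): UV stability of the d = 3 lattice theory on a finite torus, as printed, MODULO its printed inputs (the
(α) rows, now assumed on the larger `≤`-family — a hypothesis list that CONTAINS the END theorem's) — NOT a continuum limit, NOT a mass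
gap, NOT d = 4, nothing about the Millennium problem; nothing of the paper is asserted.  No `sorry`, no new axiom.
-/

noncomputable section

namespace Summit.QuantumFields.Balaban3D.Proofs.FamilyLE

open MeasureTheory Metric
open scoped BigOperators Matrix.Norms.L2Operator
open Literature.MathematicalPhysics.QuantumFieldTheory.Balaban1983to89
open Literature.MathematicalPhysics.QuantumFieldTheory.Balaban1983to89.B10
open Literature.MathematicalPhysics.QuantumFieldTheory.Balaban1983to89.B10SectAGathering
open Literature.MathematicalPhysics.QuantumFieldTheory.Balaban1983to89.TreeLengthTorus (tsys)
open Literature.MathematicalPhysics.QuantumFieldTheory.Balaban1985CMP102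
open Literature.MathematicalPhysics.QuantumFieldTheory.Balaban1985CMP102.Setting
open Literature.MathematicalPhysics.QuantumFieldTheory.Balaban1985CMP102.Theorems
open Summit.QuantumFields.Balaban3D.Carriers
open Summit.QuantumFields.Balaban3D.Proofs.ScalesArithmetic
open Summit.QuantumFields.Balaban3D.Proofs.Constants
open Summit.QuantumFields.Balaban3D.Proofs.UVStability3D
open Summit.QuantumFields.Balaban3D.Proofs.EndTheorem
open Summit.QuantumFields.Balaban3D.Proofs.Inputs
open Summit.QuantumFields.Balaban3D.Proofs.Residuals
open Summit.QuantumFields.Balaban3D.Proofs.Primitives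
open Summit.QuantumFields.Balaban3D.Proofs.Family (prov_hb₁ prov_hb₂)
open Summit.QuantumFields.Balaban3D.Proofs.Newborn46 (newborn46_std)
open Summit.QuantumFields.Balaban3D.Proofs.Bound55Std (Fibre49 Fibre57Low hint_std hint47_std)
open Summit.QuantumFields.Balaban3D.Proofs.GroupModelLieC (lieC adC hdet_lieC_pi)
open Summit.QuantumFields.Balaban3D.Proofs.UVStability3DInputs

variable {L : ℕ}

/-! ## §1 The `≤`-family and the leaf thresholds on it -/

/-- **THE `≤`-FAMILY**: all lattice approximations whose terminal coupling satisfies `g_K² = g²ε₀ ≤ γ` — print's «g_k in a bounded set» /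
«g_k sufficiently small» read as an INTERVAL of terminal couplings (contrast the spine's `Theorems.Family L eps0`: `S.ε₀ = eps0 S.g`, one
ε₀ per g). [cite: Balaban1985UV3, p.256 L15–18 + p.257 L1–2] -/
abbrev ScalesLE (L : ℕ) (γ : ℝ) : Type := {S : Scales L // S.g ^ 2 * S.ε₀ ≤ γ}

/-- The runs `i ↦ RunData` of a construction `mk` on the `≤`-family, for one group as printed (the `≤`-twin of `Theorems.runs`).
[cite: Balaban1985UV3, (1)–(5) p.256] -/
def runsLE (mk : Construction L) (G : Type) [GaugeGroup G] [MeasurableSpace G] [HaarData G] (𝔊 : GroupModel G) (γ : ℝ) :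
    ScalesLE L γ → B10.RunData :=
  fun S => (mk G 𝔊 S.1).toRunData

/-- THE EXHIBITED FAMILY LIES IN THE `≤`-FAMILY at `γ⋆ = (min γ₀ 1)²`: `S.ε₀ = ε₀(S.g) ⇒ S.g²·S.ε₀ = (min γ₀ 1)²`
(`Constants.gsq_mul_eps0Of`). [cite: Balaban1985UV3, (2) p.256] -/
theorem le_of_eps0Of (S : Scales L) {γ₀ : ℝ} (hS : S.ε₀ = eps0Of γ₀ S.g) : S.g ^ 2 * S.ε₀ ≤ (min γ₀ 1) ^ 2 := by
  rw [hS, gsq_mul_eps0Of S.g_pos]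

/-- **ON THE `≤`-FAMILY EVERY RUNNING COUPLING IS BELOW THE LEAF THRESHOLD**: `g²ε₀ ≤ (min γ₀ 1)²` ⇒ `g_k ≤ γ₀` for `k ≤ K`
(`g_k² ≤ g_K² = g²ε₀`, `ScalesArithmetic.gk_sq_le`) — the `≤`-twin of `ScalesArithmetic.gk_le_gamma0_of_eps0Of`, the ONLY form in which the
lane's step estimates consume the family equation. [cite: Balaban1985UV3, (2) + (5) p.256] -/
theorem gk_le_gamma0_of_le (S : Scales L) {γ₀ : ℝ} (hγ : 0 ≤ γ₀) (hle : S.g ^ 2 * S.ε₀ ≤ (min γ₀ 1) ^ 2) (k : ℕ) (hk : k ≤ S.K) :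
    S.gk k ≤ γ₀ := by
  have h2 : S.gk k ^ 2 ≤ (min γ₀ 1) ^ 2 := (gk_sq_le S k hk).trans hle
  exact ((pow_le_pow_iff_left₀ (gk_pos S k).le (le_min hγ zero_le_one) two_ne_zero).1 h2).trans (min_le_left _ _)

section Family

variable {N : ℕ} {𝔠 : AlphaConsts L N} {S : Scales L} (hle : S.g ^ 2 * S.ε₀ ≤ (min 𝔠.gamma0 1) ^ 2)
include hle

/-- **THE LEAF THRESHOLDS ON THE `≤`-FAMILY**, for `k ≤ K`: `g_k ≤ γ₂₈`, `g_k ≤ γ₄₆`, `g_k ≤ γ_OO`, `g_k ≤ γ₇₁` (each `γ ≥ γ₀ =` the minimum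
of the leaf seats' thresholds, `Constants.gammaMin_le`) and the (28)-smallness `cB·(r(g_k)g_kp(g_k)) ≤ ρ/4` (p6
`ChartThreshold.small28_of_le_gamma28`) — what `Family.gk_le_gamma28/46/OO/71` and `Family.small28` give on the exhibited family, obtained
from `gk_le_gamma0_of_le` instead of `gk_le_gamma0_of_eps0Of`. [cite: Balaban1985UV3, p.256 L15–18 + (28) p.263 + (45) p.267 + (71) p.273] -/
theorem thresholds_of_le (k : ℕ) (hk : k ≤ S.K) :
    S.gk k ≤ 𝔠.gamma28 ∧ S.gk k ≤ 𝔠.gamma46 ∧ S.gk k ≤ 𝔠.gammaOO ∧ S.gk k ≤ 𝔠.gamma71 ∧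
      𝔠.cB * (rFun 𝔠.r₀ (S.gk k) * S.gk k * pFun 𝔠.b₀ 𝔠.p₀ (S.gk k)) ≤ 𝔠.ρ / 4 := by
  have h0 := gk_le_gamma0_of_le S 𝔠.gamma0_pos.le hle k hk
  have h28 : S.gk k ≤ 𝔠.gamma28 := h0.trans (gammaMin_le (by simp))
  exact ⟨h28, h0.trans (gammaMin_le (by simp)), h0.trans (gammaMin_le (by simp)), h0.trans (gammaMin_le (by simp)),
    ChartThreshold.small28_of_le_gamma28 𝔠.ρ_pos 𝔠.cB_nonneg 𝔠.b₀_pos.le (le_trans zero_le_one 𝔠.one_le_r₀) 𝔠.p₀_pos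
      (gk_pos S k) h28⟩

end Family

/-! ## §2 From the (α) inputs to the residual leaves, on the `≤`-family (the bodies of `UVStability3DInputs` §2 verbatim, `hS` ↦ `hle`) -/

section Reduce

variable {S : Scales L} {G : Type} [GaugeGroup G] [MeasurableSpace G] [HaarData G] {𝔊 : GroupModel G} {𝔠 : AlphaConsts L 𝔊.N}
  {X : ExternalInputs S G} {𝔖 : ∀ k, StepSeries S G ↥(lieC 𝔊) (nblkOf S 𝔠.lane.carrier k) k} {𝔄 : AlphaData 𝔊 𝔠 X 𝔖}
  (hle : S.g ^ 2 * S.ε₀ ≤ (min 𝔠.gamma0 1) ^ 2)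
include hle

/-- **(25) FOR THE ACTIVITIES from G3D-01 + (28)** on the `≤`-family (`UVStability3DInputs.bound25_act` with `hS` weakened).
[cite: Balaban1985UV3, (25) p.262 + (28)–(29) p.263] -/
theorem bound25_act_of_le (k : ℕ) (hk : k + 1 ≤ S.K) (A : StepAlpha 𝔊 𝔠 X 𝔖 𝔄 k) (h : Hist S.P (k + 1)) :
    Bound25Printed ⟨(tsys 3 (nblkOf S 𝔠.lane.carrier k)).Dom, GaugeField S.P (k + 1) G, (tsys 3 (nblkOf S 𝔠.lane.carrier k)).dj,
      (𝔖 k).act h⟩ (S.gk k) 𝔠.κ 𝔠.C25 :=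
  ChartFromBound25.bound25_real_of_chart (T := towerOf 𝔠.lane X 𝔖) (k := k) (𝔖 k).Ψ A.chart (𝔖 k).Bcfg A.bound28
    (thresholds_of_le hle k (by omega)).2.2.2.2 h

/-- **THE RESIDUAL STEP LEAVES FROM THE (α) STEP INPUTS on the `≤`-family** (`UVStability3DInputs.stepResiduals_of_alpha` with `hS`
weakened: the thresholds (28)/`γ_OO` it consumes follow from `g_k ≤ γ₀` alone). [cite: Balaban1985UV3, (55)–(61) pp.269–271 + p.272] -/
theorem stepResiduals_of_alpha_le (k : ℕ) (hk : k + 1 ≤ S.K) (A : StepAlpha 𝔊 𝔠 X 𝔖 𝔄 k) :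
    StepResiduals 𝔠.lane X 𝔖 k := by
  haveI : RegularGaugeGroup G := groupModel_regularGaugeGroup 𝔊
  exact
  { bound55 := AlphaBound55.bound55_pieces 𝔠.lane X 𝔖 k hk
      (hint_std X 𝔠.lane.carrier 𝔖 (fun _ => True) k A.hU A.hPm (𝔄.cP k) A.hPb) A.fibre49
    bound55Lower := AlphaBound55.bound55Lower_pieces 𝔠.lane X 𝔖 k
      (hint47_std X 𝔠.lane.carrier 𝔖 (fun _ => True) k (A.hU _) (A.hPm _) (𝔄.cP k) (A.hPb _)) A.fibre57Low
    cumulant58 := AlphaCumulant.cumulant58_pieces 𝔠.lane X 𝔖 k hk A.hμ 𝔠.kappa_ge 𝔠.C25_nonneg 𝔠.one_le_r₀ 𝔠.R₁_ge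
      𝔠.Cac_nonneg rfl rfl A.hact A.hboxm A.hbox A.hVm A.hVB A.h324a A.h324c A.hG (bound25_act_of_le hle k hk A)
    cumulantLower := AlphaCumulant.cumulantLower_pieces 𝔠.lane X 𝔖 k hk A.hμ 𝔠.kappa_ge 𝔠.C25_nonneg 𝔠.one_le_r₀ 𝔠.R₁_ge
      𝔠.Cac_nonneg rfl A.hact A.hboxm A.hbox A.hVm A.hVB A.h324a A.h324c A.hG (bound25_act_of_le hle k hk A)
    repr33_60 := AlphaRepr.repr33_60_pieces 𝔠.lane X 𝔖 k hk 𝔠.chart (by linarith [𝔠.kappa_ge]) 𝔠.C25_nonneg 𝔠.C25_le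
      𝔠.κ₀_lt_half rfl A.chart A.bound28 (thresholds_of_le hle k (by omega)).2.2.2.2 (adjAct 𝔊 (P := S.P) k) A.inv26
      (hdet_adjAct 𝔊 k) A.far_le A.hPY
    vacuumWhole := AlphaRepr.vacuumWhole_pieces 𝔠.lane X 𝔖 k hk 𝔠.kappa_ge 𝔠.C25_nonneg 𝔠.one_le_r₀ 𝔠.R₁_ge rfl rfl A.chart
    decomp35_61 := AlphaRepr.decomp35_61_pieces 𝔠.lane X 𝔖 k hk 𝔠.chart rfl 𝔠.kappa_ge 𝔠.C63_nonneg 𝔠.C63_le 𝔠.one_le_r₀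
      𝔠.κ₀_lt_half 𝔠.R₁_ge rfl A.bound28 (thresholds_of_le hle k (by omega)).2.2.2.2 (adjAct 𝔊 (P := S.P) k) (hdet_adjAct 𝔊 k)
      (𝔄.Λc k) A.hPYZ
    norm35 := AlphaRepr.norm35_pieces 𝔠.lane X 𝔖 k 𝔠.c35_pos rfl A.norm35
    oldOutside := AlphaCumulant.oldOutside_pieces 𝔠.lane X 𝔖 k hk 𝔠.C44_nonneg 𝔠.B₃_pos.le 𝔠.κ₁_pos rfl A.h44 A.hfloor
      (thresholds_of_le hle k (by omega)).2.2.1 }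

/-- **THE RESIDUAL LEAVES OF THE RUN FROM THE (α) INPUTS on the `≤`-family** (`UVStability3DInputs.runResiduals_of_alpha` with `hS` weakened:
the windows `γ₄₆`, `γ₇₁` follow from `g_k ≤ γ₀` alone). [cite: Balaban1985UV3, (46) p.267 + (65) p.273 + pp.273–274] -/
theorem runResiduals_of_alpha_le (R : RunAlpha 𝔊 𝔠 X 𝔖 𝔄) : RunResiduals 𝔠.lane X 𝔖 where
  steps k hk := stepResiduals_of_alpha_le hle k hk (R.steps k hk)
  bound46 := AlphaLargeField.bound46_tower 𝔠.lane X 𝔖 𝔠.C44_nonneg 𝔠.Cnew_nonneg 𝔠.B₃_pos.le 𝔠.κ₁_pos rfl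
    (fun k hk => (R.steps k hk).h44) (fun k hk => (R.steps k hk).hfloor) (fun k hk => (thresholds_of_le hle k (by omega)).2.1)
    (fun k hk => newborn46_std X 𝔠.lane.carrier 𝔖 k (by omega) (by rw [P_m, P_K]; omega) 𝔠.chart (by linarith [𝔠.kappa_ge])
      𝔠.C25_nonneg 𝔠.C63_nonneg 𝔠.b₀_pos.le 𝔠.p₀_pos (lt_of_lt_of_le one_pos 𝔠.one_le_r₀) (R.steps k hk).chart
      (R.steps k hk).bound28 (thresholds_of_le hle k (by omega)).2.2.2.2 (R.steps k hk).far_le (R.steps k hk).hPY (𝔄.Λc k) (𝔄.N45 k)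
      (R.steps k hk).hPYZ)
  logZT_le k hk := AlphaRepr.logZT_le_pieces 𝔠.lane X 𝔖 k 𝔠.cT_pos rfl (R.steps k hk).logZT
  PprT_le k hk := AlphaCumulant.pprT_le_pieces 𝔠.lane X 𝔖 k hk (by linarith [𝔠.kappa_ge]) 𝔠.C25_nonneg rfl
    (bound25_vac k (R.steps k hk))
  lf := AlphaLargeField.lf_tower 𝔠.lane X 𝔖 𝔊 𝔠.R₁_nonneg (le_trans zero_le_one 𝔠.one_le_r₀)
    (add_nonneg 𝔠.Cz_nonneg 𝔠.Cv_nonneg) 𝔠.C₅_nonneg 𝔠.C₆_nonneg 𝔠.C68_pos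
    (fun j hj => (thresholds_of_le hle j hj.le).2.2.2.1) R.hLF67 R.h68 𝔠.prov_r₀p₀ (prov_hb₁ 𝔠 𝔊.N_pos) (prov_hb₂ 𝔠 𝔊.N_pos)

end Reduce

/-! ## §3 THE END THEOREM ON THE `≤`-FAMILY -/

/-- **BAŁABAN CMP 102 THEOREM 1 (compact-coupling-window reading) ∧ THEOREM 2 ON THE `≤`-FAMILY, MACHINE-CHECKED MODULO THE (α) INPUTS**
(cell `ym3-torus` I-3 / Q6).  For every group as printed `(G, 𝔊)`: IF the (α) inputs `RunAlpha` of `uvStability3D_of_inputs` hold for every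
lattice approximation `S` with `S.g²·S.ε₀ ≤ (min γ₀ 1)²` (terminal coupling at most the leaf threshold), THEN the densities `ρ_k = T^kρ₀` of
the CONSTRUCTED runs `(laneT 𝔠 X 𝔖).toConstruction G 𝔊 S` satisfy the bounds (5) with ONE O(1) per coupling window `[gmin, gmax]`, uniformly
over the whole `≤`-family (all ε, all tori, all K, all g), and the inequalities (41) ∧ (47) for every `k ≤ K` — via the lane's generic
`UVStability3D.uvStability3D_compact_subfamily` on the sub-family `ScalesLE`, with the leaves supplied by `runResiduals_of_alpha_le`.
The exhibited-family END theorem's hypothesis list is the restriction of this one (`le_of_eps0Of`). [cite: Balaban1985UV3, Thm 1 p.257 + Thm 2 p.272 + p.256 L15–18] -/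
theorem uvStability3D_of_inputs_le
    (𝔠 : ∀ (G : Type) [GaugeGroup G] [MeasurableSpace G] [HaarData G] (𝔊 : GroupModel G), AlphaConsts L 𝔊.N)
    (X : ∀ (G : Type) [GaugeGroup G] [MeasurableSpace G] [HaarData G], GroupModel G → ∀ S : Scales L, ExternalInputs S G)
    (𝔖 : ∀ (G : Type) [GaugeGroup G] [MeasurableSpace G] [HaarData G] (𝔊 : GroupModel G) (S : Scales L) (k : ℕ),
      StepSeries S G ↥(lieC 𝔊) (nblkOf S (𝔠 G 𝔊).lane.carrier k) k)
    (𝔄 : ∀ (G : Type) [GaugeGroup G] [MeasurableSpace G] [HaarData G] (𝔊 : GroupModel G) (S : Scales L),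
      AlphaData 𝔊 (𝔠 G 𝔊) (X G 𝔊 S) (𝔖 G 𝔊 S))
    (G : Type) [GaugeGroup G] [MeasurableSpace G] [HaarData G] (𝔊 : GroupModel G)
    (hα : ∀ S : Scales L, S.g ^ 2 * S.ε₀ ≤ (min (𝔠 G 𝔊).gamma0 1) ^ 2 → RunAlpha 𝔊 (𝔠 G 𝔊) (X G 𝔊 S) (𝔖 G 𝔊 S) (𝔄 G 𝔊 S)) :
    Thm1PrintedCompact (runsLE (laneT 𝔠 X 𝔖).toConstruction G 𝔊 ((min (𝔠 G 𝔊).gamma0 1) ^ 2)) ∧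
      Thm2Printed (runsLE (laneT 𝔠 X 𝔖).toConstruction G 𝔊 ((min (𝔠 G 𝔊).gamma0 1) ^ 2)) :=
  uvStability3D_compact_subfamily (laneT 𝔠 X 𝔖).toConstruction (𝔠 G 𝔊).lane.consts (𝔠 G 𝔊).lane.normalised (laneT 𝔠 X 𝔖).tower
    (fun G _ _ _ 𝔊 S => (laneT 𝔠 X 𝔖).tower_toRunData G 𝔊 S) (fun S : ScalesLE L ((min (𝔠 G 𝔊).gamma0 1) ^ 2) => S.1) G 𝔊
    (fun S => { toCarrierEqs := carrierEqs_pin _ (usesConsts_inputOf (𝔠 G 𝔊).lane (X G 𝔊 S.1) (𝔖 G 𝔊 S.1) fun _ => True),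
                toAnalyticLeaves := analyticLeavesOf (runResiduals_of_alpha_le S.2 (hα S.1 S.2)) })

/-- **THEOREM 2 ON THE EXHIBITED FAMILY, RECOVERED FROM THE `≤`-FAMILY** (`le_of_eps0Of`): the `≤`-reading restricts to `Theorems.runs … (eps0Of γ₀)`.
[cite: Balaban1985UV3, Thm 2 p.272 + (2) p.256] -/
theorem thm2_eps0Of_of_le
    (𝔠 : ∀ (G : Type) [GaugeGroup G] [MeasurableSpace G] [HaarData G] (𝔊 : GroupModel G), AlphaConsts L 𝔊.N)
    (X : ∀ (G : Type) [GaugeGroup G] [MeasurableSpace G] [HaarData G], GroupModel G → ∀ S : Scales L, ExternalInputs S G)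
    (𝔖 : ∀ (G : Type) [GaugeGroup G] [MeasurableSpace G] [HaarData G] (𝔊 : GroupModel G) (S : Scales L) (k : ℕ),
      StepSeries S G ↥(lieC 𝔊) (nblkOf S (𝔠 G 𝔊).lane.carrier k) k)
    (G : Type) [GaugeGroup G] [MeasurableSpace G] [HaarData G] (𝔊 : GroupModel G)
    (h : Thm2Printed (runsLE (laneT 𝔠 X 𝔖).toConstruction G 𝔊 ((min (𝔠 G 𝔊).gamma0 1) ^ 2))) :
    Thm2Printed (runs (laneT 𝔠 X 𝔖).toConstruction G 𝔊 (eps0Of (𝔠 G 𝔊).gamma0)) :=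
  fun S k hk => h ⟨S.1, le_of_eps0Of S.1 S.2⟩ k hk

end Summit.QuantumFields.Balaban3D.Proofs.FamilyLE

end
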